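import Mathlib
import Literature.Geometry.DiscreteGeometry.KissingPatterns
import Literature.MathematicalPhysics.StatisticalMechanics.LennardJonesClusters

/-!
# Route ReggeStarCoercivity — crux `StarCoercivity`, line `elastic-tier-overlap-split`:
stub `stub_separationRemoval` (S1, supports item `stmt-AtomisticToContinuum-13600`)

SEPARATION IS REMOVABLE.  If `N·e_per + g·#Def(x) − C·N^(2/3) ≤ E_LJ(x)` holds with some `g > 0`, `C` for
every `1/3`-SEPARATED `x : Fin N → ℝ³` (`e_per = ⨅_Q e(Q)` over periodic configurations, `#Def(x)` = number
of sites whose recentred `6/5`-shell, rescaled by some `a ∈ [9/10, 11/10]`, is not `1/20`-matched to the fcc or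
hcp kissing pattern), then it holds with `(min g (−e_per/56), max C 0)` for every INJECTIVE `x`.
PROOF.  (i) `g ≤ −e_per`: on `M³` collinear points at spacing `2` all shells are empty (a matched shell has
twelve points), so all sites are defective, and the energy is `≤ 0`; hence `(e_per + g)·M³ ≤ C·M²` for all `M`.
(ii) Closest-pair deletion, strong induction on `N`: a non-separated injective `x` has a closest pair at distance
`0 < r < 1/3`; deleting one of its particles `i₀` gives `E(x) = E(x ∖ i₀) + 𝓔^{i₀}(x)` with
`𝓔^{i₀}(x) ≥ r⁻¹²/12 − (250/6) r⁻⁶ > 0` (`sum_inv_pow_six_le`, `r⁻⁶ > 729 > 500`); sites farther than `6/5`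
from `x i₀` keep their shells, and star-good sites are `171/200`-separated in their `6/5`-ball, so at most `55`
of them lie within `6/5` of `x i₀` (`card_le_of_separated_of_dist_le`, `(2·(6/5)/(171/200) + 1)³ < 56`):
`#Def(x) ≤ #Def(x ∖ i₀) + 56`, and `56 · min g (−e_per/56) ≤ −e_per` closes the step.
No definitions; the crux's sub-expressions are written out verbatim.  Geometric inputs and bookkeeping adapted
from `Cruxes/StarCoercivity/DrefuteStub1Lemmas.lean`, `DrefuteStub1Proof.lean`
(refuter-drefute-stmt-AtomisticToContinuum-13600-0), which are not importable modules.
-/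

noncomputable section

open scoped BigOperators Classical

namespace Summit.AtomisticToContinuum.Crystallization.Theorems

open Literature.MathematicalPhysics.StatisticalMechanics Literature.Geometry.DiscreteGeometry

/-- `𝓔ⁱ(x) = Σ_k V(|x_i − x_k|) − V(0)`. -/
theorem separationRemoval_siteEnergy_eq_sum_sub (V : ℝ → ℝ) {N : ℕ} (x : Fin N → EuclideanSpace ℝ (Fin 3))
    (i : Fin N) : siteEnergy V x i = ∑ k, V (dist (x i) (x k)) - V 0 := by
  unfold siteEnergy
  rw [Finset.sum_erase_eq_sub (Finset.mem_univ i), dist_self]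

/-- `E(x) = E(x ∖ i₀) + 𝓔^{i₀}(x)` (exact, for any pair potential `V`). -/
theorem separationRemoval_interactionEnergy_succAbove (V : ℝ → ℝ) {n : ℕ}
    (x : Fin (n + 1) → EuclideanSpace ℝ (Fin 3)) (i₀ : Fin (n + 1)) :
    interactionEnergy V x = interactionEnergy V (x ∘ i₀.succAbove) + siteEnergy V x i₀ := by
  -- adapted from Cruxes/StarCoercivity/DrefuteStub1Proof.lean (refuter-drefute-stmt-AtomisticToContinuum-13600-0)
  have h2 := two_mul_interactionEnergy V x
  have h2' := two_mul_interactionEnergy V (x ∘ i₀.succAbove)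
  rw [Fin.sum_univ_succAbove _ i₀] at h2
  have hs : ∀ i', siteEnergy V x (i₀.succAbove i') =
      siteEnergy V (x ∘ i₀.succAbove) i' + V (dist (x (i₀.succAbove i')) (x i₀)) := by
    intro i'
    rw [separationRemoval_siteEnergy_eq_sum_sub, separationRemoval_siteEnergy_eq_sum_sub,
      Fin.sum_univ_succAbove _ i₀]
    simp only [Function.comp_apply]
    ring
  have h0 : ∑ i', V (dist (x (i₀.succAbove i')) (x i₀)) = siteEnergy V x i₀ := by
    rw [separationRemoval_siteEnergy_eq_sum_sub, Fin.sum_univ_succAbove _ i₀, dist_self, add_sub_cancel_left]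
    exact Finset.sum_congr rfl fun k _ => by rw [dist_comm]
  simp only [hs, Finset.sum_add_distrib] at h2
  linarith [h2, h2', h0]

/-- **Positive site energy at a closest pair**: if all mutual distances are `≥ r`, `0 < r < 1/3`, and `r` is
attained at `(i₀, j₀)`, then `𝓔^{i₀}(x) > 0` (`Σ d⁻⁶ ≤ 250 r⁻⁶` by `sum_inv_pow_six_le`, `Σ d⁻¹² ≥ (r⁻⁶)²`,
`r⁻⁶ > 3⁶ = 729 > 500`). -/
theorem separationRemoval_siteEnergy_pos_of_closest {N : ℕ} (x : Fin N → EuclideanSpace ℝ (Fin 3)) {r : ℝ}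
    (hr : 0 < r) (hr3 : r < 1 / 3) (hsep : ∀ k l : Fin N, k ≠ l → r ≤ dist (x k) (x l)) {i₀ j₀ : Fin N}
    (hij : i₀ ≠ j₀) (hrd : dist (x i₀) (x j₀) = r) : 0 < siteEnergy lennardJones x i₀ := by
  -- adapted from Cruxes/StarCoercivity/DrefuteStub1Lemmas.lean (refuter-drefute-stmt-AtomisticToContinuum-13600-0)
  have hS := sum_inv_pow_six_le x hr hsep i₀
  have h12 : r⁻¹ ^ 12 ≤ ∑ k ∈ Finset.univ.erase i₀, (dist (x i₀) (x k))⁻¹ ^ 12 := by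
    have hj : j₀ ∈ Finset.univ.erase i₀ := Finset.mem_erase.2 ⟨hij.symm, Finset.mem_univ _⟩
    have := Finset.single_le_sum (f := fun k => (dist (x i₀) (x k))⁻¹ ^ 12) (fun k _ => by positivity) hj
    simpa [hrd] using this
  have hexp : siteEnergy lennardJones x i₀ =
      (1 / 12) * ∑ k ∈ Finset.univ.erase i₀, (dist (x i₀) (x k))⁻¹ ^ 12 -
        (1 / 6) * ∑ k ∈ Finset.univ.erase i₀, (dist (x i₀) (x k))⁻¹ ^ 6 := by
    simp only [siteEnergy, lennardJones, Finset.sum_sub_distrib, Finset.mul_sum]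
  have h3 : 3 < r⁻¹ := by rw [lt_inv_comm₀ (by norm_num) hr]; linarith [show (3 : ℝ)⁻¹ = 1 / 3 by norm_num]
  have hu : (729 : ℝ) < r⁻¹ ^ 6 := (by norm_num : (729 : ℝ) = 3 ^ 6) ▸ pow_lt_pow_left₀ h3 (by norm_num) (by norm_num)
  have h12' : r⁻¹ ^ 12 = (r⁻¹ ^ 6) ^ 2 := by ring
  have hu' : 729 * r⁻¹ ^ 6 < r⁻¹ ^ 6 * r⁻¹ ^ 6 := mul_lt_mul_of_pos_right hu (by linarith)
  rw [h12', sq] at h12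
  rw [hexp]
  nlinarith

/-- Points of `A(K)`, `K` a kissing pattern and `A` a linear isometry, are unit vectors. -/
theorem separationRemoval_norm_eq_one_of_mem_image {K : Finset (EuclideanSpace ℝ (Fin 3))}
    (hK : K = fccKissingPattern ∨ K = hcpKissingPattern)
    (A : EuclideanSpace ℝ (Fin 3) →ₗᵢ[ℝ] EuclideanSpace ℝ (Fin 3)) {p : EuclideanSpace ℝ (Fin 3)}
    (hp : p ∈ K.image A) : ‖p‖ = 1 := by
  obtain ⟨v, hv, rfl⟩ := Finset.mem_image.1 hp
  rw [A.norm_map]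
  rcases hK with rfl | rfl
  · exact norm_eq_one_of_mem_fccKissingPattern hv
  · exact norm_eq_one_of_mem_hcpKissingPattern hv

/-- **Matched shells are `171/200`-separated from their centre**: if a finite set `S` is `1/20`-matched (after
a linear isometry) to the fcc or hcp kissing pattern and contains `a⁻¹ • (v − u)` with `a ≥ 9/10`, then
`dist u v ≥ 171/200 = (9/10)·(19/20)` (the point is within `1/20` of a unit vector). -/
theorem separationRemoval_dist_ge_of_matched {S : Finset (EuclideanSpace ℝ (Fin 3))} {a : ℝ} (ha : 9 / 10 ≤ a)
    (hS : ShellCloseTo (1 / 20) S fccKissingPattern ∨ ShellCloseTo (1 / 20) S hcpKissingPattern)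
    {u v : EuclideanSpace ℝ (Fin 3)} (hmem : a⁻¹ • (v - u) ∈ S) : 171 / 200 ≤ dist u v := by
  -- adapted from Cruxes/StarCoercivity/DrefuteStub1Lemmas.lean (refuter-drefute-stmt-AtomisticToContinuum-13600-0)
  have ha0 : 0 < a := by linarith
  have key : ∀ K : Finset (EuclideanSpace ℝ (Fin 3)), (K = fccKissingPattern ∨ K = hcpKissingPattern) →
      ShellCloseTo (1 / 20) S K → 171 / 200 ≤ dist u v := by
    intro K hK ⟨A, e, he⟩
    have h1 : dist (a⁻¹ • (v - u)) ((e ⟨_, hmem⟩ : ↥(K.image A)) : EuclideanSpace ℝ (Fin 3)) ≤ 1 / 20 :=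
      he ⟨_, hmem⟩
    have hp : ‖((e ⟨_, hmem⟩ : ↥(K.image A)) : EuclideanSpace ℝ (Fin 3))‖ = 1 :=
      separationRemoval_norm_eq_one_of_mem_image hK A (e ⟨_, hmem⟩).2
    have h2 : (19 / 20 : ℝ) ≤ ‖a⁻¹ • (v - u)‖ := by
      have := norm_sub_norm_le ((e ⟨_, hmem⟩ : ↥(K.image A)) : EuclideanSpace ℝ (Fin 3)) (a⁻¹ • (v - u))
      rw [hp, ← dist_eq_norm, dist_comm] at this
      linarith
    rw [norm_smul, norm_inv, Real.norm_of_nonneg ha0.le, ← dist_eq_norm, dist_comm, le_inv_mul_iff₀ ha0] at h2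
    nlinarith
  rcases hS with h | h
  · exact key _ (Or.inl rfl) h
  · exact key _ (Or.inr rfl) h

/-- **The packing count behind `56`**: at most `55` points with pairwise distances `≥ 171/200` lie in a closed
ball of radius `6/5` of `ℝ³` (`(2·(6/5)/(171/200) + 1)³ = 55.18… < 56`). -/
theorem separationRemoval_card_le_55 (s : Finset (EuclideanSpace ℝ (Fin 3))) (p : EuclideanSpace ℝ (Fin 3))
    (hs : ∀ c ∈ s, dist c p ≤ 6 / 5) (hsep : ∀ c ∈ s, ∀ d ∈ s, c ≠ d → (171 / 200 : ℝ) ≤ dist c d) :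
    s.card ≤ 55 := by
  -- adapted from Cruxes/StarCoercivity/DrefuteStub1Lemmas.lean (refuter-drefute-stmt-AtomisticToContinuum-13600-0)
  have h := card_le_of_separated_of_dist_le s p (by norm_num : (0 : ℝ) < 171 / 200)
    (by norm_num : (0 : ℝ) ≤ 6 / 5) hs hsep
  rw [finrank_euclideanSpace, Fintype.card_fin] at h
  exact Nat.lt_succ_iff.1 (by exact_mod_cast (lt_of_le_of_lt h (by norm_num) : (s.card : ℝ) < 56))

/-- Sites farther than `6/5` from the deleted particle `x i₀` keep their rescaled shells: the shell of
`i₀.succAbove i'` read in `x` is the shell of `i'` read in `x ∘ i₀.succAbove`. -/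
theorem separationRemoval_shell_succAbove {n : ℕ} (x : Fin (n + 1) → EuclideanSpace ℝ (Fin 3)) (i₀ : Fin (n + 1))
    {i' : Fin n} (hfar : ¬ dist (x (i₀.succAbove i')) (x i₀) ≤ 6 / 5) (a : ℝ) :
    ((Finset.univ.filter fun j : Fin (n + 1) => j ≠ (i₀.succAbove i') ∧ dist (x (i₀.succAbove i')) (x j) ≤ 6 / 5).image
            fun j => a⁻¹ • (x j - x (i₀.succAbove i'))) =
      ((Finset.univ.filter fun j : Fin n => j ≠ i' ∧ dist ((x ∘ i₀.succAbove) i') ((x ∘ i₀.succAbove) j) ≤ 6 / 5).image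
            fun j => a⁻¹ • ((x ∘ i₀.succAbove) j - (x ∘ i₀.succAbove) i')) := by
  ext v
  simp only [Finset.mem_image, Finset.mem_filter, Finset.mem_univ, true_and, Function.comp_apply]
  constructor
  · rintro ⟨j, ⟨hj1, hj2⟩, rfl⟩
    rcases Fin.eq_self_or_eq_succAbove i₀ j with rfl | ⟨j', rfl⟩
    · exact absurd hj2 hfar
    · exact ⟨j', ⟨fun h => hj1 (by rw [h]), hj2⟩, rfl⟩
  · rintro ⟨j', ⟨hj1, hj2⟩, rfl⟩
    exact ⟨i₀.succAbove j', ⟨fun h => hj1 (Fin.succAbove_right_injective h), hj2⟩, rfl⟩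

/-- **Abstract recount.**  For predicates `G` on `Fin (n+1)` and `G'` on `Fin n` that agree along `i₀.succAbove`
outside an exceptional set `S`, the failures of `G` number at most the failures of `G'`, plus one (the index
`i₀`), plus the members of `S` satisfying `G'`. -/
theorem separationRemoval_card_not_le {n : ℕ} (i₀ : Fin (n + 1)) {G : Fin (n + 1) → Prop} {G' : Fin n → Prop}
    (S : Finset (Fin n)) (hfar : ∀ i', i' ∉ S → (G (i₀.succAbove i') ↔ G' i')) :
    Nat.card {i // ¬ G i} ≤ Nat.card {i // ¬ G' i} + 1 + (S.filter G').card := by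
  rw [Nat.card_eq_fintype_card, Fintype.card_subtype, Nat.card_eq_fintype_card, Fintype.card_subtype]
  have hsub : (Finset.univ.filter fun i => ¬ G i) ⊆
      insert i₀ (((Finset.univ.filter fun i' => ¬ G' i') ∪ S.filter G').map (Fin.succAboveEmb i₀)) := by
    intro i hi
    have hbad : ¬ G i := (Finset.mem_filter.1 hi).2
    rcases Fin.eq_self_or_eq_succAbove i₀ i with rfl | ⟨i', rfl⟩
    · exact Finset.mem_insert_self _ _
    · refine Finset.mem_insert_of_mem (Finset.mem_map.2 ⟨i', Finset.mem_union.2 ?_, rfl⟩)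
      by_cases hS : i' ∈ S
      · by_cases hg : G' i'
        · exact Or.inr (Finset.mem_filter.2 ⟨hS, hg⟩)
        · exact Or.inl (Finset.mem_filter.2 ⟨Finset.mem_univ _, hg⟩)
      · exact Or.inl (Finset.mem_filter.2 ⟨Finset.mem_univ _, fun h => hbad ((hfar i' hS).2 h)⟩)
  have h1 := (Finset.card_le_card hsub).trans (Finset.card_insert_le _ _)
  rw [Finset.card_map] at h1
  have h2 := Finset.card_union_le (Finset.univ.filter fun i' => ¬ G' i') (S.filter G')
  omega

/-- At most `55` sites of `x ∖ i₀` that are star-good there lie within `6/5` of the deleted particle `x i₀`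
(their positions are distinct points of the closed `6/5`-ball about `x i₀`, pairwise `≥ 171/200` apart). -/
theorem separationRemoval_card_flip_le {n : ℕ} (x : Fin (n + 1) → EuclideanSpace ℝ (Fin 3)) (i₀ : Fin (n + 1))
    (hx : Function.Injective x) :
    ((Finset.univ.filter fun i' : Fin n => dist (x (i₀.succAbove i')) (x i₀) ≤ 6 / 5).filter
        fun i' : Fin n => ∃ a : ℝ, 9 / 10 ≤ a ∧ a ≤ 11 / 10 ∧
          (ShellCloseTo (1 / 20) ((Finset.univ.filter fun j : Fin n => j ≠ i' ∧ dist ((x ∘ i₀.succAbove) i') ((x ∘ i₀.succAbove) j) ≤ 6 / 5).image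
            fun j => a⁻¹ • ((x ∘ i₀.succAbove) j - (x ∘ i₀.succAbove) i')) fccKissingPattern ∨
            ShellCloseTo (1 / 20) ((Finset.univ.filter fun j : Fin n => j ≠ i' ∧ dist ((x ∘ i₀.succAbove) i') ((x ∘ i₀.succAbove) j) ≤ 6 / 5).image
            fun j => a⁻¹ • ((x ∘ i₀.succAbove) j - (x ∘ i₀.succAbove) i')) hcpKissingPattern)).card ≤ 55 := by
  -- adapted from Cruxes/StarCoercivity/DrefuteStub1Proof.lean (refuter-drefute-stmt-AtomisticToContinuum-13600-0)
  set x' : Fin n → EuclideanSpace ℝ (Fin 3) := x ∘ i₀.succAbove with hx'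
  set F := ((Finset.univ.filter fun i' : Fin n => dist (x (i₀.succAbove i')) (x i₀) ≤ 6 / 5).filter
        fun i' : Fin n => ∃ a : ℝ, 9 / 10 ≤ a ∧ a ≤ 11 / 10 ∧
          (ShellCloseTo (1 / 20) ((Finset.univ.filter fun j : Fin n => j ≠ i' ∧ dist (x' i') (x' j) ≤ 6 / 5).image
            fun j => a⁻¹ • (x' j - x' i')) fccKissingPattern ∨
            ShellCloseTo (1 / 20) ((Finset.univ.filter fun j : Fin n => j ≠ i' ∧ dist (x' i') (x' j) ≤ 6 / 5).image
            fun j => a⁻¹ • (x' j - x' i')) hcpKissingPattern)) with hF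
  rw [← Finset.card_image_of_injective F (hx.comp Fin.succAbove_right_injective : Function.Injective x')]
  refine separationRemoval_card_le_55 _ (x i₀) ?_ ?_
  · intro c hc
    obtain ⟨i', hi', rfl⟩ := Finset.mem_image.1 hc
    exact (Finset.mem_filter.1 (Finset.mem_filter.1 hi').1).2
  · intro c hc d hd hcd
    obtain ⟨i', hi', rfl⟩ := Finset.mem_image.1 hc
    obtain ⟨k', hk', rfl⟩ := Finset.mem_image.1 hd
    have hik : k' ≠ i' := fun h => hcd (by rw [h])
    by_cases hle : dist (x' i') (x' k') ≤ 6 / 5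
    · obtain ⟨a, ha, -, hclose⟩ := (Finset.mem_filter.1 hi').2
      exact separationRemoval_dist_ge_of_matched ha hclose
        (Finset.mem_image_of_mem _ (Finset.mem_filter.2 ⟨Finset.mem_univ _, hik, hle⟩))
    · push Not at hle
      linarith

/-- **Defect recount**: deleting one particle `i₀` of an injective configuration `x : Fin (n+1) → ℝ³` raises the
crux's defect count by at most `56 = 1 + 55` relative to the smaller configuration `x ∘ i₀.succAbove`. -/
theorem separationRemoval_defects_le_succ {n : ℕ} (x : Fin (n + 1) → EuclideanSpace ℝ (Fin 3)) (i₀ : Fin (n + 1))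
    (hx : Function.Injective x) :
    Nat.card {i : Fin (n + 1) // ¬ ∃ a : ℝ, 9 / 10 ≤ a ∧ a ≤ 11 / 10 ∧
        (ShellCloseTo (1 / 20) ((Finset.univ.filter fun j : Fin (n + 1) => j ≠ i ∧ dist (x i) (x j) ≤ 6 / 5).image
            fun j => a⁻¹ • (x j - x i)) fccKissingPattern ∨
          ShellCloseTo (1 / 20) ((Finset.univ.filter fun j : Fin (n + 1) => j ≠ i ∧ dist (x i) (x j) ≤ 6 / 5).image
            fun j => a⁻¹ • (x j - x i)) hcpKissingPattern)} ≤
      Nat.card {i : Fin n // ¬ ∃ a : ℝ, 9 / 10 ≤ a ∧ a ≤ 11 / 10 ∧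
        (ShellCloseTo (1 / 20) ((Finset.univ.filter fun j : Fin n => j ≠ i ∧ dist ((x ∘ i₀.succAbove) i) ((x ∘ i₀.succAbove) j) ≤ 6 / 5).image
            fun j => a⁻¹ • ((x ∘ i₀.succAbove) j - (x ∘ i₀.succAbove) i)) fccKissingPattern ∨
          ShellCloseTo (1 / 20) ((Finset.univ.filter fun j : Fin n => j ≠ i ∧ dist ((x ∘ i₀.succAbove) i) ((x ∘ i₀.succAbove) j) ≤ 6 / 5).image
            fun j => a⁻¹ • ((x ∘ i₀.succAbove) j - (x ∘ i₀.succAbove) i)) hcpKissingPattern)} + 56 := by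
  have h := separationRemoval_card_not_le i₀
    (G := fun i : Fin (n + 1) => ∃ a : ℝ, 9 / 10 ≤ a ∧ a ≤ 11 / 10 ∧
      (ShellCloseTo (1 / 20) ((Finset.univ.filter fun j : Fin (n + 1) => j ≠ i ∧ dist (x i) (x j) ≤ 6 / 5).image
            fun j => a⁻¹ • (x j - x i)) fccKissingPattern ∨
        ShellCloseTo (1 / 20) ((Finset.univ.filter fun j : Fin (n + 1) => j ≠ i ∧ dist (x i) (x j) ≤ 6 / 5).image
            fun j => a⁻¹ • (x j - x i)) hcpKissingPattern))
    (G' := fun i' : Fin n => ∃ a : ℝ, 9 / 10 ≤ a ∧ a ≤ 11 / 10 ∧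
      (ShellCloseTo (1 / 20) ((Finset.univ.filter fun j : Fin n => j ≠ i' ∧ dist ((x ∘ i₀.succAbove) i') ((x ∘ i₀.succAbove) j) ≤ 6 / 5).image
            fun j => a⁻¹ • ((x ∘ i₀.succAbove) j - (x ∘ i₀.succAbove) i')) fccKissingPattern ∨
        ShellCloseTo (1 / 20) ((Finset.univ.filter fun j : Fin n => j ≠ i' ∧ dist ((x ∘ i₀.succAbove) i') ((x ∘ i₀.succAbove) j) ≤ 6 / 5).image
            fun j => a⁻¹ • ((x ∘ i₀.succAbove) j - (x ∘ i₀.succAbove) i')) hcpKissingPattern))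
    (Finset.univ.filter fun i' : Fin n => dist (x (i₀.succAbove i')) (x i₀) ≤ 6 / 5)
    (fun i' hi' => by simp only [separationRemoval_shell_succAbove x i₀ (by simpa using hi')])
  have h55 := separationRemoval_card_flip_le x i₀ hx
  omega

/-- `(M³)^(2/3) = M²`. -/
theorem separationRemoval_cube_rpow_two_thirds (M : ℕ) : (((M : ℝ) ^ 3) ^ (2 / 3 : ℝ)) = (M : ℝ) ^ 2 := by
  rw [show ((M : ℝ) ^ 3) = (M : ℝ) ^ (3 : ℝ) by norm_cast, ← Real.rpow_mul (Nat.cast_nonneg M)]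
  norm_num

/-- Points `(2i) • e`, `e` a unit vector, indexed by `Fin N`, are pairwise `≥ 2` apart. -/
theorem separationRemoval_two_le_dist_line {e : EuclideanSpace ℝ (Fin 3)} (he : ‖e‖ = 1) {N : ℕ} {i j : Fin N}
    (hij : i ≠ j) : 2 ≤ dist (((2 : ℝ) * ((i : ℕ) : ℝ)) • e) (((2 : ℝ) * ((j : ℕ) : ℝ)) • e) := by
  simp only [dist_eq_norm, ← sub_smul, norm_smul, he, mul_one, ← mul_sub, Real.norm_eq_abs, abs_mul, abs_two]
  have hne : (i : ℕ) ≠ (j : ℕ) := fun h => hij (Fin.ext h)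
  have h1 : (1 : ℝ) ≤ |((i : ℕ) : ℝ) - ((j : ℕ) : ℝ)| := by
    rcases Nat.lt_or_gt_of_ne hne with h | h
    · exact le_abs.2 (Or.inr (by linarith [(by exact_mod_cast h : ((i : ℕ) : ℝ) + 1 ≤ ((j : ℕ) : ℝ))]))
    · exact le_abs.2 (Or.inl (by linarith [(by exact_mod_cast h : ((j : ℕ) : ℝ) + 1 ≤ ((i : ℕ) : ℝ))]))
  linarith

/-- If all mutual distances exceed `6/5`, every shell is empty, so every site is star-defective (a matched
shell has twelve points, `card_eq_twelve_of_shellCloseTo`). -/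
theorem separationRemoval_not_good_of_sparse {N : ℕ} {x : Fin N → EuclideanSpace ℝ (Fin 3)}
    (h : ∀ i j : Fin N, i ≠ j → (6 / 5 : ℝ) < dist (x i) (x j)) (i : Fin N) :
    ¬ ∃ a : ℝ, 9 / 10 ≤ a ∧ a ≤ 11 / 10 ∧
      (ShellCloseTo (1 / 20) ((Finset.univ.filter fun j : Fin N => j ≠ i ∧ dist (x i) (x j) ≤ 6 / 5).image
            fun j => a⁻¹ • (x j - x i)) fccKissingPattern ∨
        ShellCloseTo (1 / 20) ((Finset.univ.filter fun j : Fin N => j ≠ i ∧ dist (x i) (x j) ≤ 6 / 5).image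
            fun j => a⁻¹ • (x j - x i)) hcpKissingPattern) := by
  rintro ⟨a, -, -, hclose⟩
  have h12 := card_eq_twelve_of_shellCloseTo hclose
  rw [Finset.card_image_of_injOn, Finset.filter_eq_empty_iff.2] at h12
  · simp at h12
  · rintro j - ⟨hji, hdist⟩
    exact absurd hdist (not_le.2 (h i j (Ne.symm hji)))
  · rw [Finset.filter_eq_empty_iff.2]
    · simp
    · rintro j - ⟨hji, hdist⟩
      exact absurd hdist (not_le.2 (h i j (Ne.symm hji)))

/-- If all mutual distances are `≥ 1`, the Lennard-Jones energy is `≤ 0` (`lennardJones_nonpos`). -/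
theorem separationRemoval_energy_nonpos_of_sparse {N : ℕ} {x : Fin N → EuclideanSpace ℝ (Fin 3)}
    (h : ∀ i j : Fin N, i ≠ j → (1 : ℝ) ≤ dist (x i) (x j)) : interactionEnergy lennardJones x ≤ 0 := by
  unfold interactionEnergy
  refine Finset.sum_nonpos fun i _ => Finset.sum_nonpos fun j hj => ?_
  exact lennardJones_nonpos (h i j (Finset.mem_Ioi.1 hj).ne)

/-- **S1 — separation removal** (line `elastic-tier-overlap-split` of crux `StarCoercivity`,
item `stmt-AtomisticToContinuum-13600`).  If `N·e_per + g·#Def(x) − C·N^(2/3) ≤ E_LJ(x)` holds with some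
`g > 0` and `C` for all `1/3`-separated configurations, then it holds with `(min g (−e_per/56), max C 0)` for
all injective ones.  The collinear competitor `i ↦ (2i) • e₀` on `M³` points gives `(e_per + g)·M³ ≤ C·M²`,
hence `g ≤ −e_per` and `e_per < 0`; then closest-pair deletion by strong induction on `N`
(`separationRemoval_interactionEnergy_succAbove`, `separationRemoval_siteEnergy_pos_of_closest`,
`separationRemoval_defects_le_succ`). -/
theorem stub_separationRemoval :
    (∃ g : ℝ, 0 < g ∧ ∃ C : ℝ, ∀ (N : ℕ) (x : Fin N → EuclideanSpace ℝ (Fin 3)),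
        (∀ i j : Fin N, i ≠ j → (1 / 3 : ℝ) ≤ dist (x i) (x j)) →
        (N : ℝ) * (⨅ Q : PeriodicConfiguration 3, Q.energyPerParticle lennardJones)
            + g * (Nat.card {i : Fin N // ¬ ∃ a : ℝ, 9 / 10 ≤ a ∧ a ≤ 11 / 10 ∧
                (ShellCloseTo (1 / 20) ((Finset.univ.filter fun j : Fin N => j ≠ i ∧ dist (x i) (x j) ≤ 6 / 5).image
                    fun j => a⁻¹ • (x j - x i)) fccKissingPattern ∨
                  ShellCloseTo (1 / 20) ((Finset.univ.filter fun j : Fin N => j ≠ i ∧ dist (x i) (x j) ≤ 6 / 5).image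
                    fun j => a⁻¹ • (x j - x i)) hcpKissingPattern)} : ℝ)
            - C * (N : ℝ) ^ (2 / 3 : ℝ) ≤ interactionEnergy lennardJones x) →
      ∃ g : ℝ, 0 < g ∧ ∃ C : ℝ, ∀ (N : ℕ) (x : Fin N → EuclideanSpace ℝ (Fin 3)), Function.Injective x →
        (N : ℝ) * (⨅ Q : PeriodicConfiguration 3, Q.energyPerParticle lennardJones)
            + g * (Nat.card {i : Fin N // ¬ ∃ a : ℝ, 9 / 10 ≤ a ∧ a ≤ 11 / 10 ∧
                (ShellCloseTo (1 / 20) ((Finset.univ.filter fun j : Fin N => j ≠ i ∧ dist (x i) (x j) ≤ 6 / 5).image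
                    fun j => a⁻¹ • (x j - x i)) fccKissingPattern ∨
                  ShellCloseTo (1 / 20) ((Finset.univ.filter fun j : Fin N => j ≠ i ∧ dist (x i) (x j) ≤ 6 / 5).image
                    fun j => a⁻¹ • (x j - x i)) hcpKissingPattern)} : ℝ)
            - C * (N : ℝ) ^ (2 / 3 : ℝ) ≤ interactionEnergy lennardJones x := by
  -- adapted from Cruxes/StarCoercivity/DrefuteStub1Proof.lean (refuter-drefute-stmt-AtomisticToContinuum-13600-0)
  rintro ⟨g, hg, C, hC⟩
  set eP : ℝ := (⨅ Q : PeriodicConfiguration 3, Q.energyPerParticle lennardJones) with heP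
  -- Step (i): the collinear competitor forces `g ≤ -e_per`
  have hgle : g ≤ -eP := by
    by_contra hlt
    push Not at hlt
    set c : ℝ := eP + g with hc_def
    have hc : 0 < c := by rw [hc_def]; linarith
    obtain ⟨M, hM⟩ := exists_nat_gt (|C| / c)
    have hMpos : (0 : ℝ) < M := lt_of_le_of_lt (by positivity) hM
    set L : Fin (M ^ 3) → EuclideanSpace ℝ (Fin 3) :=
      fun i => ((2 : ℝ) * ((i : ℕ) : ℝ)) • EuclideanSpace.single (0 : Fin 3) (1 : ℝ) with hL
    have hLd : ∀ i j : Fin (M ^ 3), i ≠ j → 2 ≤ dist (L i) (L j) := fun i j hij =>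
      separationRemoval_two_le_dist_line (e := EuclideanSpace.single (0 : Fin 3) (1 : ℝ)) (by simp) hij
    have key := hC (M ^ 3) L (fun i j hij => by linarith [hLd i j hij])
    rw [Nat.card_congr (Equiv.subtypeUnivEquiv
      (separationRemoval_not_good_of_sparse (x := L) fun i j hij => by linarith [hLd i j hij])), Nat.card_eq_fintype_card,
      Fintype.card_fin] at key
    have hE := separationRemoval_energy_nonpos_of_sparse (x := L) (fun i j hij => by linarith [hLd i j hij])
    push_cast at key
    rw [separationRemoval_cube_rpow_two_thirds] at key
    have h1 : c * (M : ℝ) ^ 3 ≤ C * (M : ℝ) ^ 2 := by rw [hc_def]; nlinarith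
    have h2 : c * (M : ℝ) ≤ C := by
      have hM2 : (0 : ℝ) < (M : ℝ) ^ 2 := by positivity
      exact le_of_mul_le_mul_right (by nlinarith : c * (M : ℝ) * (M : ℝ) ^ 2 ≤ C * (M : ℝ) ^ 2) hM2
    have h3 : |C| < c * (M : ℝ) := by rwa [div_lt_iff₀ hc, mul_comm] at hM
    linarith [le_abs_self C]
  have he : eP < 0 := by linarith
  -- Step (ii): closest-pair deletion with constants `g' = min g (-e_per/56)`, `C' = max C 0`
  refine ⟨min g (-eP / 56), lt_min hg (by linarith), max C 0, ?_⟩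
  set g' : ℝ := min g (-eP / 56) with hg'
  set C' : ℝ := max C 0 with hC'
  have hg'g : g' ≤ g := min_le_left _ _
  have hg'0 : 0 ≤ g' := le_min hg.le (by linarith)
  have hC'C : C ≤ C' := le_max_left _ _
  have hC'0 : 0 ≤ C' := le_max_right _ _
  have h56 : 56 * g' ≤ -eP := by
    have := min_le_right g (-eP / 56)
    rw [le_div_iff₀ (by norm_num : (0 : ℝ) < 56)] at this
    linarith
  intro N
  induction N using Nat.strong_induction_on with
  | _ N ih =>
  intro x hx
  by_cases hs : ∀ i j : Fin N, i ≠ j → (1 / 3 : ℝ) ≤ dist (x i) (x j)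
  · -- separated: the hypothesis with weaker constants
    have h := hC N x hs
    have hD : (0 : ℝ) ≤ (Nat.card {i : Fin N // ¬ ∃ a : ℝ, 9 / 10 ≤ a ∧ a ≤ 11 / 10 ∧
        (ShellCloseTo (1 / 20) ((Finset.univ.filter fun j : Fin N => j ≠ i ∧ dist (x i) (x j) ≤ 6 / 5).image
            fun j => a⁻¹ • (x j - x i)) fccKissingPattern ∨
          ShellCloseTo (1 / 20) ((Finset.univ.filter fun j : Fin N => j ≠ i ∧ dist (x i) (x j) ≤ 6 / 5).image
            fun j => a⁻¹ • (x j - x i)) hcpKissingPattern)} : ℝ) := Nat.cast_nonneg _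
    have hP : (0 : ℝ) ≤ (N : ℝ) ^ (2 / 3 : ℝ) := Real.rpow_nonneg (Nat.cast_nonneg _) _
    nlinarith [mul_le_mul_of_nonneg_right hg'g hD, mul_le_mul_of_nonneg_right hC'C hP]
  · -- a closest pair `(i₀, j₀)` at distance `r < 1/3`; delete `i₀`
    push Not at hs
    obtain ⟨i₁, j₁, hij₁, hlt⟩ := hs
    obtain ⟨p, hp, hmin⟩ := Finset.exists_min_image Finset.univ.offDiag
      (fun p : Fin N × Fin N => dist (x p.1) (x p.2)) ⟨(i₁, j₁), by simp [hij₁]⟩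
    obtain ⟨i₀, j₀⟩ := p
    have hij₀ : i₀ ≠ j₀ := by simpa using hp
    have hr : 0 < dist (x i₀) (x j₀) := dist_pos.2 (hx.ne hij₀)
    have hsepr : ∀ k l, k ≠ l → dist (x i₀) (x j₀) ≤ dist (x k) (x l) := fun k l hkl => hmin (k, l) (by simp [hkl])
    have hr3 : dist (x i₀) (x j₀) < 1 / 3 := (hsepr i₁ j₁ hij₁).trans_lt hlt
    obtain ⟨n, rfl⟩ : ∃ n, N = n + 1 := Nat.exists_eq_succ_of_ne_zero (Fin.pos i₀).ne'
    set x' : Fin n → EuclideanSpace ℝ (Fin 3) := x ∘ i₀.succAbove with hx'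
    have hih := ih n (Nat.lt_succ_self n) x' (hx.comp Fin.succAbove_right_injective)
    have hE : interactionEnergy lennardJones x = interactionEnergy lennardJones x' + siteEnergy lennardJones x i₀ :=
      separationRemoval_interactionEnergy_succAbove lennardJones x i₀
    have hsite : 0 < siteEnergy lennardJones x i₀ :=
      separationRemoval_siteEnergy_pos_of_closest x hr hr3 hsepr hij₀ rfl
    have hdef : (Nat.card {i : Fin (n + 1) // ¬ ∃ a : ℝ, 9 / 10 ≤ a ∧ a ≤ 11 / 10 ∧
        (ShellCloseTo (1 / 20) ((Finset.univ.filter fun j : Fin (n + 1) => j ≠ i ∧ dist (x i) (x j) ≤ 6 / 5).image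
            fun j => a⁻¹ • (x j - x i)) fccKissingPattern ∨
          ShellCloseTo (1 / 20) ((Finset.univ.filter fun j : Fin (n + 1) => j ≠ i ∧ dist (x i) (x j) ≤ 6 / 5).image
            fun j => a⁻¹ • (x j - x i)) hcpKissingPattern)} : ℝ) ≤
        (Nat.card {i : Fin n // ¬ ∃ a : ℝ, 9 / 10 ≤ a ∧ a ≤ 11 / 10 ∧
        (ShellCloseTo (1 / 20) ((Finset.univ.filter fun j : Fin n => j ≠ i ∧ dist (x' i) (x' j) ≤ 6 / 5).image
            fun j => a⁻¹ • (x' j - x' i)) fccKissingPattern ∨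
          ShellCloseTo (1 / 20) ((Finset.univ.filter fun j : Fin n => j ≠ i ∧ dist (x' i) (x' j) ≤ 6 / 5).image
            fun j => a⁻¹ • (x' j - x' i)) hcpKissingPattern)} : ℝ) + 56 := by
      exact_mod_cast separationRemoval_defects_le_succ x i₀ hx
    have hpow : ((n : ℕ) : ℝ) ^ (2 / 3 : ℝ) ≤ ((n + 1 : ℕ) : ℝ) ^ (2 / 3 : ℝ) :=
      Real.rpow_le_rpow (Nat.cast_nonneg _) (by push_cast; linarith) (by norm_num)
    push_cast at hih hpow ⊢
    nlinarith [mul_le_mul_of_nonneg_left hdef hg'0, mul_le_mul_of_nonneg_left hpow hC'0]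

end Summit.AtomisticToContinuum.Crystallization.Theorems

end
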